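import Mathlib
import HarnessLib
import Summits.HubbardSuperconductivity.HubbardSuperconductivity.Theorems.KLProgrammeH10TwoPointLimitSectorMultiplierDiffs
import Summits.HubbardSuperconductivity.HubbardSuperconductivity.Theorems.KLProgrammeKLRegimeSymbolAngularFactorPairThird
import Summits.HubbardSuperconductivity.HubbardSuperconductivity.Theorems.KLProgrammeKLRegimeFatMultiplierPackThird
import Summits.HubbardSuperconductivity.HubbardSuperconductivity.Theorems.KLProgrammeKLRegimeSymbolFrameInstanceSingle

/-!
# Route `KLProgramme` — engine support, route (L2): the POINTWISE THIRD differences of the two-multiplier symbol `F_{ω₁}(k)F_{ω₂}(k)`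
# (`klAnisoFamily` at scales `n₂ ≤ n₁` on an admissible frame) in the time direction and along any integer spatial step (isotropic form)

Cell `gate-hubbard-kl`, seat p3 (g10); program «W2 = weighted overlap rows» (KL STATUS 2026-08-27 19:05Z), file W2b: p4's
`…SectorMultiplierDiffs` (orders `≤ 2`: `norm_fwdDiff_two_time_klAnisoPair_le`, `norm_fwdDiff_two_space_klAnisoPair_le`) one order up —
the `h₀, h₁, h₂, h₃′` inputs of the MIXED master lemma `sum_wt_norm_charSum_le_of_mixed_differences` for the thin pair.  Same section
variables as p4's file plus the order-three cutoff constant `hd3`, the `C³` frame datum `hA3 : ‖D³(frameShift K)‖ ≤ A₃` and the angular constant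
of `exists_norm_iteratedDeriv_sectorWeightCirc_polarAngle_line_le 3`:

* **`norm_fwdDiff_three_time_klAnisoPair_le`** — `‖Δ³_{(1,0)} G̃(q)‖ ≤ (8g₃ + 12g₂)|2π/β|³·1/Λ_{n₁}³` (window `Λ_{n₁}β < π(2M − 5)`;
  `g₂, g₃` the product-profile constants of `scaleProfile_mul_bounds₃`);
* **`norm_fwdDiff_three_space_klAnisoPair_le`** — along an integer step `u` with `6π|u_j| ≤ zL` (`w = 2πu/L`): the ISOTROPIC bound of
  `…SymbolSampledThirdZone` with `τ = (4+2A)‖w‖`, `K₂ = 4+4A`, `K₃ = 4+8A₃`, angular sizes `z₁ = 6B(D₁+D₂)`, `z₂ = 6B(D₁²+D₂²)+72B²D₁D₂`,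
  `z₃ = 6B(D₁³+D₂³)+108B²(D₁²D₂+D₁D₂²)`, `D_i = (1+6/w_{n_i})‖w₁+iw₂‖` (`abs_derivs3_angularFactorPair_line_le`).

Everything is proved; no definitions, no named facts. [folklore] (BGM 2006 §2.5 Lemma 2.2 (2.52)–(2.56), §2.7 (2.71a).)
-/

noncomputable section

namespace Summit.HubbardSuperconductivity.HubbardSuperconductivity.Theorems.TorusFourierL2

set_option linter.dupNamespace false -- summit = problem name (single-conjunct summit), D-0017

open Set Finset Literature.MathematicalPhysics.QuantumLattice Literature.MathematicalPhysics.QuantumLattice.BandSectorCounting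
open Literature.MathematicalPhysics.QuantumLattice.FermiRG Literature.Probability.LatticeModels Literature.Analysis.SpecialFunctions
open Summit.HubbardSuperconductivity.HubbardSuperconductivity.Theorems.DispersionFlow
open Summit.HubbardSuperconductivity.HubbardSuperconductivity.Theorems.KLRegimeSplit
open Summit.HubbardSuperconductivity.HubbardSuperconductivity.Theorems.KLProgrammeLegKernels
open Summit.HubbardSuperconductivity.HubbardSuperconductivity.Theorems.PerturbedFermiCurve
open scoped Real Nat

section Pair

variable {L M : ℕ} [NeZero L] [NeZero M] {K : TrigPolyC4v} {A A₃ : ℝ}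
  (hA : ∀ p : Momentum, ∀ j ≤ 2, ‖iteratedFDeriv ℝ j (frameShift K) p‖ ≤ A)
  (hA3 : ∀ p : Momentum, ‖iteratedFDeriv ℝ 3 (frameShift K) p‖ ≤ A₃)
  {μ e₀ z β : ℝ} (he : 0 < e₀) (hz : 0 < z) (hz1 : z ≤ 1) (hgap : e₀ + A + z ^ 2 < -μ) (h3 : e₀ + A - μ ≤ 3) (hβ : 0 < β)
  {n₁ n₂ : ℕ} (hn : n₂ ≤ n₁) (ω₁ : Fin (sectorCount n₁)) (ω₂ : Fin (sectorCount n₂))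
  {d : ℝ} (hd : 0 ≤ d) (hd1 : ∀ u, |deriv (bgmCutoffSq e₀) u| ≤ d) (hd2 : ∀ u, |iteratedDeriv 2 (bgmCutoffSq e₀) u| ≤ d)
  (hd3 : ∀ u, |iteratedDeriv 3 (bgmCutoffSq e₀) u| ≤ d)
  {Z : (Fin 2 → ℝ) → ℝ}
  (hZ : ∀ p, Z p = gnCutoff ((π + z) ^ 2 / π ^ 2) ((π + z) ^ 2) (p 0 ^ 2) * gnCutoff ((π + z) ^ 2 / π ^ 2) ((π + z) ^ 2) (p 1 ^ 2) *
    ((radialCutoffC (1 / 2) (momToComplex p) * sectorWeightCirc n₁ ((ω₁ : ℕ) : ℤ) (polarAngle p)) *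
      (radialCutoffC (1 / 2) (momToComplex p) * sectorWeightCirc n₂ ((ω₂ : ℕ) : ℤ) (polarAngle p))))
  {Φ : ℝ × (Fin 2 → ℝ) → ℂ}
  (hΦ : ∀ k₀ p, Φ (k₀, p) = ((bgmCutoffSq e₀ ((16 : ℝ) ^ n₁ * (k₀ ^ 2 + frameLevel μ K (WithLp.toLp 2 p) ^ 2)) *
      bgmCutoffSq e₀ ((16 : ℝ) ^ n₂ * (k₀ ^ 2 + frameLevel μ K (WithLp.toLp 2 p) ^ 2)) * Z p : ℝ) : ℂ))
  {Gs : TorusSite 1 (2 * M) × TorusSite 2 L → ℂ}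
  (hGs : ∀ q, Gs q = klAnisoFamily L M β μ K e₀ n₁ ω₁ (⟨(q.1 0).val, ZMod.val_lt (q.1 0)⟩, q.2) *
    klAnisoFamily L M β μ K e₀ n₂ ω₂ (⟨(q.1 0).val, ZMod.val_lt (q.1 0)⟩, q.2))

include hA he hz h3 hβ hn hd hd1 hd2 hd3 hZ hΦ hGs in
/-- **Time direction, order three**: `‖Δ³_{(1,0)} G̃(q)‖ ≤ (8g₃ + 12g₂)|2π/β|³·1/Λ_{n₁}³` for every `q`, provided `Λ_{n₁}β < π(2M − 5)`.
[cite: BenfattoGiulianiMastropietro2006, §2.5 Lemma 2.2 (2.52), (2.56)] -/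
theorem norm_fwdDiff_three_time_klAnisoPair_le (hM : klScale e₀ n₁ * β < π * (2 * M - 5)) (q : TorusSite 1 (2 * M) × TorusSite 2 L) :
    ‖((fwdDiff ((fun _ : Fin 1 => (1 : ZMod (2 * M))), (0 : TorusSite 2 L)))^[3] Gs) q‖ ≤
      (8 * (d * e₀ ^ 6 * 1 + 3 * (d * e₀ ^ 4) * (d * e₀ ^ 2) + 3 * (d * e₀ ^ 2) * (d * e₀ ^ 4) + 1 * (d * e₀ ^ 6)) +
          12 * (d * e₀ ^ 4 * 1 + 2 * (d * e₀ ^ 2) * (d * e₀ ^ 2) + 1 * (d * e₀ ^ 4))) *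
        |2 * π / β| ^ 3 * 1 / klScale e₀ n₁ ^ 3 := by
  obtain ⟨hGc, -, hG1, hG2, hG3, hGv⟩ := scaleProfile_mul_bounds₃ he hn hd hd1 hd2 hd3
  have hΛ : 0 < klScale e₀ n₁ := by rw [klScale]; positivity
  exact norm_fwdDiff_three_time_sampledSymbol_le hGc hΛ (by positivity) (by positivity) (by positivity) hG1 hG2 hG3 hGv
    (fun p : Fin 2 → ℝ => frameLevel μ K (WithLp.toLp 2 p)) Z (abs_angularFactor_le_one hZ) Φ (fun k₀ p => hΦ k₀ p)
    (π * (1 - 2 * M) / β) (2 * π / β) (2 * π / L) (fun m hm => symbol_window₃ hβ hM m hm) Gs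
    (klAnisoPair_eq_sample hA he hz h3 ω₁ ω₂ hZ hΦ hGs) q

include hA hA3 he hz hz1 hgap h3 hn hd hd1 hd2 hd3 hZ hΦ hGs in
/-- **Space direction, order three, isotropic form** along an integer step `u` with `6π|u_j| ≤ zL` (`w = 2πu/L`): with the angular constant `B` of
`exists_norm_iteratedDeriv_sectorWeightCirc_polarAngle_line_le 3`, `τ = (4+2A)‖w‖`, `K₂ = 4+4A`, `K₃ = 4+8A₃`, `D_i = (1+6/w_{n_i})‖w₁+iw₂‖`
and the product-profile constants `g₁, g₂, g₃`: for EVERY `q`,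
`‖Δ³_{(0,ū)} G̃(q)‖ ≤ [(8g₃+12g₂)τ³/Λ³ + (12g₂+6g₁)τK₂‖w‖²/Λ² + 2g₁K₃‖w‖³/Λ]·1 + 3[(4g₂+2g₁)τ²/Λ² + 2g₁K₂‖w‖²/Λ]·z₁ + 3(2g₁τ/Λ)·z₂ + 1·z₃`,
`Λ = Λ_{n₁}`. [cite: BenfattoGiulianiMastropietro2006, §2.5 Lemma 2.2 (2.53)–(2.55), §2.7 (2.71a)] -/
theorem norm_fwdDiff_three_space_klAnisoPair_le {Ba : ℝ} (hB0 : 0 ≤ Ba)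
    (hB : ∀ (i : ℕ), i ≤ 3 → ∀ (n : ℕ) (ω : ℤ) (θ₀ : ℝ) (q w : Fin 2 → ℝ) (t : ℝ) {r₀ : ℝ}, 0 < r₀ →
      r₀ ≤ ‖momToComplex (q + t • w)‖ → |sectorRelAngle θ₀ (q + t • w)| < π →
      ‖iteratedDeriv i (fun t : ℝ => sectorWeightCirc n ω (polarAngle (q + t • w))) t‖ ≤
        (3 : ℕ)! * Ba * ((1 + (sectorWidth n)⁻¹ * (3 : ℕ)!) * ‖momToComplex w‖ / r₀) ^ i)
    (u : Fin 2 → ℤ) (hu : ∀ j, 3 * |2 * π / L| * |(u j : ℝ)| ≤ z) (q : TorusSite 1 (2 * M) × TorusSite 2 L) :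
    ‖((fwdDiff ((0 : TorusSite 1 (2 * M)), (fun j => ((u j : ℤ) : ZMod L))))^[3] Gs) q‖ ≤
      ((8 * (d * e₀ ^ 6 * 1 + 3 * (d * e₀ ^ 4) * (d * e₀ ^ 2) + 3 * (d * e₀ ^ 2) * (d * e₀ ^ 4) + 1 * (d * e₀ ^ 6)) +
              12 * (d * e₀ ^ 4 * 1 + 2 * (d * e₀ ^ 2) * (d * e₀ ^ 2) + 1 * (d * e₀ ^ 4))) *
            ((4 + 2 * A) * ‖(fun j => 2 * π / L * (u j : ℝ))‖) ^ 3 / klScale e₀ n₁ ^ 3 +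
          (12 * (d * e₀ ^ 4 * 1 + 2 * (d * e₀ ^ 2) * (d * e₀ ^ 2) + 1 * (d * e₀ ^ 4)) + 6 * (d * e₀ ^ 2 * 1 + 1 * (d * e₀ ^ 2))) *
            (((4 + 2 * A) * ‖(fun j => 2 * π / L * (u j : ℝ))‖) * ((4 + 4 * A) * ‖(fun j => 2 * π / L * (u j : ℝ))‖ ^ 2)) /
              klScale e₀ n₁ ^ 2 +
          2 * (d * e₀ ^ 2 * 1 + 1 * (d * e₀ ^ 2)) * ((4 + 8 * A₃) * ‖(fun j => 2 * π / L * (u j : ℝ))‖ ^ 3) / klScale e₀ n₁) * 1 +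
        3 * (((4 * (d * e₀ ^ 4 * 1 + 2 * (d * e₀ ^ 2) * (d * e₀ ^ 2) + 1 * (d * e₀ ^ 4)) + 2 * (d * e₀ ^ 2 * 1 + 1 * (d * e₀ ^ 2))) *
                ((4 + 2 * A) * ‖(fun j => 2 * π / L * (u j : ℝ))‖) ^ 2 / klScale e₀ n₁ ^ 2 +
              2 * (d * e₀ ^ 2 * 1 + 1 * (d * e₀ ^ 2)) * ((4 + 4 * A) * ‖(fun j => 2 * π / L * (u j : ℝ))‖ ^ 2) / klScale e₀ n₁) *
            (6 * Ba * (((1 + 6 * (sectorWidth n₁)⁻¹) * ‖momToComplex (fun j => 2 * π / L * (u j : ℝ))‖) +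
              ((1 + 6 * (sectorWidth n₂)⁻¹) * ‖momToComplex (fun j => 2 * π / L * (u j : ℝ))‖)))) +
        3 * (2 * (d * e₀ ^ 2 * 1 + 1 * (d * e₀ ^ 2)) * ((4 + 2 * A) * ‖(fun j => 2 * π / L * (u j : ℝ))‖) / klScale e₀ n₁ *
            (6 * Ba * (((1 + 6 * (sectorWidth n₁)⁻¹) * ‖momToComplex (fun j => 2 * π / L * (u j : ℝ))‖) ^ 2 +
                ((1 + 6 * (sectorWidth n₂)⁻¹) * ‖momToComplex (fun j => 2 * π / L * (u j : ℝ))‖) ^ 2) +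
              72 * Ba ^ 2 * (((1 + 6 * (sectorWidth n₁)⁻¹) * ‖momToComplex (fun j => 2 * π / L * (u j : ℝ))‖) *
                ((1 + 6 * (sectorWidth n₂)⁻¹) * ‖momToComplex (fun j => 2 * π / L * (u j : ℝ))‖)))) +
        1 * (6 * Ba * (((1 + 6 * (sectorWidth n₁)⁻¹) * ‖momToComplex (fun j => 2 * π / L * (u j : ℝ))‖) ^ 3 +
                ((1 + 6 * (sectorWidth n₂)⁻¹) * ‖momToComplex (fun j => 2 * π / L * (u j : ℝ))‖) ^ 3) +
              108 * Ba ^ 2 * (((1 + 6 * (sectorWidth n₁)⁻¹) * ‖momToComplex (fun j => 2 * π / L * (u j : ℝ))‖) ^ 2 *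
                  ((1 + 6 * (sectorWidth n₂)⁻¹) * ‖momToComplex (fun j => 2 * π / L * (u j : ℝ))‖) +
                ((1 + 6 * (sectorWidth n₁)⁻¹) * ‖momToComplex (fun j => 2 * π / L * (u j : ℝ))‖) *
                  ((1 + 6 * (sectorWidth n₂)⁻¹) * ‖momToComplex (fun j => 2 * π / L * (u j : ℝ))‖) ^ 2)) := by
  obtain ⟨hGc, hG0, hG1, hG2, hG3, hGv⟩ := scaleProfile_mul_bounds₃ he hn hd hd1 hd2 hd3
  have hΛ : 0 < klScale e₀ n₁ := by rw [klScale]; positivity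
  have hΛe : klScale e₀ n₁ ≤ e₀ := klScale_le_e0 he.le n₁
  have hL : (0 : ℝ) < L := Nat.cast_pos.2 (Nat.pos_of_ne_zero (NeZero.ne L))
  set w : Fin 2 → ℝ := fun j => 2 * π / L * (u j : ℝ) with hw
  set eK : (Fin 2 → ℝ) → ℝ := fun p => frameLevel μ K (WithLp.toLp 2 p) with heK
  have hD : ∀ n : ℕ, 0 ≤ (1 + 6 * (sectorWidth n)⁻¹) * ‖momToComplex w‖ := fun n => by
    have := sectorWidth_pos n; positivity
  -- points of the enlarged square in the shell are in the open square and in the Fermi region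
  have hinner : ∀ p : Fin 2 → ℝ, (∀ i, |p i| ≤ π + z) → |eK p| ≤ klScale e₀ n₁ → (∀ i, |p i| < π) ∧ 1 ≤ ‖momToComplex p‖ := by
    intro p hsq hshell
    refine ⟨fun i => ?_, one_le_norm_of_frameBand_le hA h3 (hshell.trans hΛe)⟩
    by_contra hge
    push Not at hge
    have h1 : π - z ≤ |p i| := by linarith
    have := frameBand_zone hA hz1 hgap h1 (hsq i)
    exact absurd (hshell.trans hΛe) (not_le.2 this)
  have hZ1 : ∀ (p₀ : Fin 2 → ℝ) (s : ℝ), (∀ i, |(p₀ + s • w) i| ≤ π + z) → |eK (p₀ + s • w)| ≤ klScale e₀ n₁ →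
      |deriv (fun s : ℝ => Z (p₀ + s • w)) s| ≤
        6 * Ba * (((1 + 6 * (sectorWidth n₁)⁻¹) * ‖momToComplex w‖) + ((1 + 6 * (sectorWidth n₂)⁻¹) * ‖momToComplex w‖)) := by
    intro p₀ s hsq hshell
    obtain ⟨hin, hfermi⟩ := hinner _ hsq hshell
    exact (abs_derivs3_angularFactorPair_line_le hz hZ hB0 hB p₀ w hin hfermi).1
  have hZ2 : ∀ (p₀ : Fin 2 → ℝ) (s : ℝ), (∀ i, |(p₀ + s • w) i| ≤ π + z) → |eK (p₀ + s • w)| ≤ klScale e₀ n₁ →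
      |iteratedDeriv 2 (fun s : ℝ => Z (p₀ + s • w)) s| ≤
        6 * Ba * (((1 + 6 * (sectorWidth n₁)⁻¹) * ‖momToComplex w‖) ^ 2 + ((1 + 6 * (sectorWidth n₂)⁻¹) * ‖momToComplex w‖) ^ 2) +
          72 * Ba ^ 2 * (((1 + 6 * (sectorWidth n₁)⁻¹) * ‖momToComplex w‖) * ((1 + 6 * (sectorWidth n₂)⁻¹) * ‖momToComplex w‖)) := by
    intro p₀ s hsq hshell
    obtain ⟨hin, hfermi⟩ := hinner _ hsq hshell
    exact (abs_derivs3_angularFactorPair_line_le hz hZ hB0 hB p₀ w hin hfermi).2.1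
  have hZ3 : ∀ (p₀ : Fin 2 → ℝ) (s : ℝ), (∀ i, |(p₀ + s • w) i| ≤ π + z) → |eK (p₀ + s • w)| ≤ klScale e₀ n₁ →
      |iteratedDeriv 3 (fun s : ℝ => Z (p₀ + s • w)) s| ≤
        6 * Ba * (((1 + 6 * (sectorWidth n₁)⁻¹) * ‖momToComplex w‖) ^ 3 + ((1 + 6 * (sectorWidth n₂)⁻¹) * ‖momToComplex w‖) ^ 3) +
          108 * Ba ^ 2 * (((1 + 6 * (sectorWidth n₁)⁻¹) * ‖momToComplex w‖) ^ 2 * ((1 + 6 * (sectorWidth n₂)⁻¹) * ‖momToComplex w‖) +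
            ((1 + 6 * (sectorWidth n₁)⁻¹) * ‖momToComplex w‖) * ((1 + 6 * (sectorWidth n₂)⁻¹) * ‖momToComplex w‖) ^ 2) := by
    intro p₀ s hsq hshell
    obtain ⟨hin, hfermi⟩ := hinner _ hsq hshell
    exact (abs_derivs3_angularFactorPair_line_le hz hZ hB0 hB p₀ w hin hfermi).2.2
  have hxL : |2 * π / (L : ℝ)| * L = 2 * π := by
    rw [abs_of_pos (by positivity)]; field_simp
  have hτ : ∀ p : Fin 2 → ℝ, |fderiv ℝ eK p w| ≤ (4 + 2 * A) * ‖w‖ := fun p => abs_fderiv_frameBand_apply_le hA μ p w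
  exact norm_fwdDiff_three_space_sampledSymbol_le' hGc hΛ zero_le_one (by positivity) (by positivity) (by positivity) hG0 hG1 hG2 hG3 hGv
    (contDiff_three_frameBand μ K) (norm_iteratedFDeriv_two_frameBand_le hA μ) (norm_iteratedFDeriv_three_frameBand_le hA3 μ) w hτ
    (contDiff_angularFactor hZ) zero_le_one
    (mul_nonneg (mul_nonneg (by norm_num) hB0) (add_nonneg (hD n₁) (hD n₂)))
    (add_nonneg (mul_nonneg (mul_nonneg (by norm_num) hB0) (add_nonneg (sq_nonneg _) (sq_nonneg _)))
      (mul_nonneg (by positivity) (mul_nonneg (hD n₁) (hD n₂))))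
    (add_nonneg (mul_nonneg (mul_nonneg (by norm_num) hB0) (add_nonneg (pow_nonneg (hD n₁) 3) (pow_nonneg (hD n₂) 3)))
      (mul_nonneg (by positivity) (add_nonneg (mul_nonneg (sq_nonneg _) (hD n₂)) (mul_nonneg (hD n₁) (sq_nonneg _)))))
    (abs_angularFactor_le_one hZ) hZ1 hZ2 hZ3
    Φ (fun k₀ p => hΦ k₀ p) (π * (1 - 2 * M) / β) (2 * π / β) (2 * π / L) u rfl hu
    (fun k₀ p hp => symbol_zone hA he hz hz1 hgap ω₁ ω₂ hZ hΦ k₀ p hp) hxL Gs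
    (klAnisoPair_eq_sample hA he hz h3 ω₁ ω₂ hZ hΦ hGs) q

end Pair

end Summit.HubbardSuperconductivity.HubbardSuperconductivity.Theorems.TorusFourierL2

end
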